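import Literature.Topology.FourManifolds.DehnSurgery
import Literature.Topology.FourManifolds.DehnSurgeryProofs
import Literature.Topology.FourManifolds.CircleSurgery
import Literature.Topology.FourManifolds.TwistedAxisSatellite
import HarnessLib

/-!
# `0`-friends and axis-compatible `0`-friends

Definitions (with bodies; no named facts) for the bookkeeping of `0`-surgery homeomorphisms that
carry a common framed AXIS, as produced by special RBG links, in the relational surgery language
of `DehnSurgery.lean` (`Knot.TubularNbhd`, `HasFraming`, `surgeryRel`, `IsIntegralSurgery`) and
`CircleSurgery.lean` (`IsOpenGluingWith`); the companion notions — the splice relation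
`spliceRel`, twisted satellites `Knot.IsTwistedAxisSatellite` and axis patterns
`Knot.IsAxisPattern` — are those of `TwistedAxisSatellite.lean` (imported):

* `ZeroFriends K K'` — some `3`-manifold `Y` is `0`-surgery on both `K` and `K'` ("knots with the
  same `0`-surgery");
* `AxisFriends K K' η η'` — `0`-friends with COMPATIBLE AXES: one `Y` carries two `0`-surgery
  pictures whose gluing maps send `0`-framed tubes of `η ⊂ S³ ∖ K` and `η' ⊂ S³ ∖ K'` to the same
  parametrised tube in `Y`;
with the API lemmas `ZeroFriends.symm`, `ZeroFriends.refl` (every knot is a `0`-friend of itself —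
existence of surgery, `exists_isIntegralSurgery_holds`), `AxisFriends.zeroFriends`,
`AxisFriends.symm`, `AxisFriends.of_isOpenGluingWith` (one `0`-surgery picture with a `0`-framed
tube of `η` off `K` gives `AxisFriends K K η η`).

## What the sources print

* Manolescu–Piccirillo, *From zero surgeries to candidates for exotic definite 4-manifolds*,
  J. LMS (2023) = arXiv:2102.04391 (`ManolescuPiccirillo2023`): Def. 1.1 (RBG link
  `L = R ∪ B ∪ G`, framings `r, b, g`, homeomorphisms `ψ_B : S³_{r,g}(R ∪ G) → S³`,
  `ψ_G : S³_{r,b}(R ∪ B) → S³`, `H₁(S³_{r,b,g}(L); ℤ) = ℤ`); Thm. 1.2: "Any RBG link `L` has a pair of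
  associated knots `K_B` and `K_G` and homeomorphism `φ_L : S³_0(K_B) → S³_0(K_G)`. Conversely, for
  any 0-surgery homeomorphism `φ : S³_0(K) → S³_0(K')` there is an associated RBG link `L_φ` with
  `K_B = K'` and `K_G = K`."; special RBG links: `B`, `G` `0`-framed unknots, `μ_R` a meridian of
  `R`, link isotopies `R ∪ B ≅ R ∪ μ_R ≅ R ∪ G` (§1, after Thm. 1.2), and "for a special RBG link,
  the homeomorphism `ψ_G : S³_{r,0}(R, B) → S³` is given by the slam-dunk homeomorphism of `B` over
  `R`" (§4.1).
* Nakamura, *Trace embeddings from zero surgery homeomorphisms*, J. Topology (2023) =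
  arXiv:2203.14270 (`Nakamura2023`), §3.3: the special RBG link `L[J]` (local connected sum of `J`
  into `R`), "`K_B[J]` and `K_G[J]` are both satellites `P_B(J)` and `P_G(J)` of `J`", "these
  patterns have winding number equal to the linking number `ℓ` of `B` and `G`".

## Conventions and flags

* All tubes are ORIENTED tubular neighbourhoods (`Knot.TubularNbhd.det_pos`), so framings are
  integers with a definite sign (`DehnSurgery.lean`).
* `ZeroFriends`/`AxisFriends` quantify over `Y : Type` (universe `0`) with `ChartedSpace (𝔼 3) Y`
  only, as `exists_isIntegralSurgery` does; smoothness of `Y` is carried by the gluing maps; the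
  orientation class of the implied homeomorphism `S³_0(K) → S³_0(K')` is not asserted (as in
  [ManolescuPiccirillo2023, Thm. 1.2]).
* These two notions transcribe the in-file definitions of the route line
  `Summits/SmoothPoincare4/…/Cruxes/ZseCruxRasmussen/Lines/lz_transport_theta_window.lean` (same
  bodies), so that line can import them together with `TwistedAxisSatellite.lean`; the `3`-manifold
  lemma "satellites of axis-friends along the common axis are `0`-friends" is a route obligation
  there (`stub_axisFriends_satellite`), not a vendored fact.

## References

* C. Manolescu, L. Piccirillo, J. Lond. Math. Soc. (2) 108 (2023), arXiv:2102.04391, Def. 1.1,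
  Thm. 1.2, §4.1 [ManolescuPiccirillo2023].
* K. Nakamura, J. Topol. 16 (2023), arXiv:2203.14270, §3.3 [Nakamura2023].
* R. E. Gompf, A. I. Stipsicz, *4-Manifolds and Kirby Calculus* (1999), §5.3 (Dehn surgery)
  [GompfStipsicz1999].
-/

noncomputable section

open scoped Manifold ContDiff Topology
open Function Set

namespace Literature.Topology.FourManifolds

/-- Local notation: `𝔼 n` is `EuclideanSpace ℝ (Fin n)`. -/
local notation "𝔼 " n:arg => EuclideanSpace ℝ (Fin n)

/-- Local notation: `𝕊 n` is the unit sphere in `EuclideanSpace ℝ (Fin (n + 1))`. -/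
local notation "𝕊 " n:arg => (Metric.sphere (0 : EuclideanSpace ℝ (Fin (n + 1))) 1)

/-! ### `0`-friends -/

/-- `K` and `K'` are **`0`-friends** ("have the same `0`-surgery"): some `3`-manifold `Y` is
`0`-surgery on both, `IsIntegralSurgery (𝓡 3) Y K 0 ∧ IsIntegralSurgery (𝓡 3) Y K' 0` — the
relation realised by the knots `K_B`, `K_G` of an RBG link. [cite: ManolescuPiccirillo2023, Thm. 1.2] -/
def ZeroFriends (K K' : Knot) : Prop :=
  ∃ (Y : Type) (_ : TopologicalSpace Y) (_ : ChartedSpace (𝔼 3) Y),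
    IsIntegralSurgery (𝓡 3) Y K 0 ∧ IsIntegralSurgery (𝓡 3) Y K' 0

/-- `0`-friendship is symmetric. [folklore] -/
theorem ZeroFriends.symm {K K' : Knot} (h : ZeroFriends K K') : ZeroFriends K' K := by
  obtain ⟨Y, _, _, hK, hK'⟩ := h
  exact ⟨Y, ‹_›, ‹_›, hK', hK⟩

/-- `0`-friendship is reflexive: `0`-surgery on `K` exists (`exists_isIntegralSurgery_holds`).
[cite: GompfStipsicz1999, §5.3] -/
theorem ZeroFriends.refl (K : Knot) : ZeroFriends K K := by
  obtain ⟨Y, _, _, _, _, _, _, hY⟩ := exists_isIntegralSurgery_holds K 0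
  exact ⟨Y, ‹_›, ‹_›, hY, hY⟩

/-! ### Axis-compatible `0`-friends -/

/-- `K`, `K'` are **`0`-friends with compatible axes `η`, `η'`**: one `Y` carries two `0`-surgery
pictures (`IsOpenGluingWith … (surgeryRel νK) jA jB`, `IsOpenGluingWith … (surgeryRel νK') jA' jB'`
with `νK`, `νK'` of framing `0`) whose gluing maps send `0`-framed oriented tubular neighbourhoods
`νη` of `η ⊂ S³ ∖ K` and `νη'` of `η' ⊂ S³ ∖ K'` to the SAME parametrised tube in `Y`:
`jA ∘ νη = jA' ∘ νη'`. Intended instance: `K = K_B`, `K' = K_G` of a special RBG link and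
`η = η' = μ_R`, the meridian of `R`, seen from the two slam-dunk pictures of
`Y = S³_{r,0,0}(R ∪ B ∪ G)` ("Any RBG link `L` has a pair of associated knots `K_B` and `K_G` and
homeomorphism `φ_L : S³_0(K_B) → S³_0(K_G)`" [cite: ManolescuPiccirillo2023, Thm. 1.2]; "for a
special RBG link, the homeomorphism `ψ_G : S³_{r,0}(R,B) → S³` is given by the slam-dunk
homeomorphism of `B` over `R`" [cite: ManolescuPiccirillo2023, §4.1]). [cite: ManolescuPiccirillo2023, Thm. 1.2] -/
def AxisFriends (K K' η η' : Knot) : Prop :=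
  ∃ (Y : Type) (_ : TopologicalSpace Y) (_ : ChartedSpace (𝔼 3) Y)
    (νK : Knot.TubularNbhd K) (νK' : Knot.TubularNbhd K')
    (jA : K.complement → Y) (jB : solidTorus → Y) (jA' : K'.complement → Y) (jB' : solidTorus → Y)
    (νη : Knot.TubularNbhd η) (νη' : Knot.TubularNbhd η')
    (hη : Disjoint (range νη) (range K)) (hη' : Disjoint (range νη') (range K')),
    νK.HasFraming 0 ∧ νK'.HasFraming 0 ∧ νη.HasFraming 0 ∧ νη'.HasFraming 0 ∧
    IsOpenGluingWith (𝓡 3) (𝓘(ℝ, 𝔼 2).prod (𝓡 1)) (𝓡 3) (surgeryRel νK) jA jB ∧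
    IsOpenGluingWith (𝓡 3) (𝓘(ℝ, 𝔼 2).prod (𝓡 1)) (𝓡 3) (surgeryRel νK') jA' jB' ∧
    ∀ p, jA ⟨νη p, νη.apply_mem_complement hη p⟩ = jA' ⟨νη' p, νη'.apply_mem_complement hη' p⟩

/-- Axis-compatible `0`-friends are `0`-friends (forget the axes). [folklore] -/
theorem AxisFriends.zeroFriends {K K' η η' : Knot} (h : AxisFriends K K' η η') :
    ZeroFriends K K' := by
  obtain ⟨Y, _, _, νK, νK', jA, jB, jA', jB', νη, νη', hη, hη', hfK, hfK', -, -, hG, hG', -⟩ := h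
  exact ⟨Y, ‹_›, ‹_›, ⟨νK, hfK, hG.isOpenGluing⟩, ⟨νK', hfK', hG'.isOpenGluing⟩⟩

/-- Axis-compatible `0`-friendship is symmetric (swap the two pictures). [folklore] -/
theorem AxisFriends.symm {K K' η η' : Knot} (h : AxisFriends K K' η η') :
    AxisFriends K' K η' η := by
  obtain ⟨Y, _, _, νK, νK', jA, jB, jA', jB', νη, νη', hη, hη', hfK, hfK', hfη, hfη', hG, hG', hax⟩ :=
    h
  exact ⟨Y, ‹_›, ‹_›, νK', νK, jA', jB', jA, jB, νη', νη, hη', hη, hfK', hfK, hfη', hfη, hG', hG,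
    fun p => (hax p).symm⟩

/-- **One picture, one axis.** A single `0`-surgery picture of `Y` on `K` (framing-`0` tube `νK`,
gluing maps `jA`, `jB`) together with a `0`-framed tube `νη` of `η` missing `K` makes `(K, η)`
axis-compatible `0`-friends with itself — the diagonal instance of `AxisFriends`. [folklore] -/
theorem AxisFriends.of_isOpenGluingWith {K η : Knot} {Y : Type} [TopologicalSpace Y]
    [ChartedSpace (𝔼 3) Y] {νK : Knot.TubularNbhd K} {jA : K.complement → Y}
    {jB : solidTorus → Y}
    (hG : IsOpenGluingWith (𝓡 3) (𝓘(ℝ, 𝔼 2).prod (𝓡 1)) (𝓡 3) (surgeryRel νK) jA jB)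
    (hfK : νK.HasFraming 0) {νη : Knot.TubularNbhd η} (hfη : νη.HasFraming 0)
    (hη : Disjoint (range νη) (range K)) : AxisFriends K K η η :=
  ⟨Y, ‹_›, ‹_›, νK, νK, jA, jB, jA, jB, νη, νη, hη, hη, hfK, hfK, hfη, hfη, hG, hG, fun _ => rfl⟩

end Literature.Topology.FourManifolds

end
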